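import Summits.ValiantsHypothesis.ValiantsHypothesis.Theses.FermionizationDimension
import Summits.ValiantsHypothesis.ValiantsHypothesis.Theses.TwistedDetRank
import Summits.ValiantsHypothesis.ValiantsHypothesis.Theorems.TwistedDetRankTdrSuperadditive
import Summits.ValiantsHypothesis.ValiantsHypothesis.Theorems.TwistedDetRankTdrPerNotQP
import Summits.ValiantsHypothesis.ValiantsHypothesis.Theorems.FermionizationDimensionSDimPerNotQPExpLowerBound

/-!
# Route FermionizationDimension — crux `SDimPerNotQP` (stmt-ValiantsHypothesis-7286): helpers

Helper results for the crux `SDimPerNotQP` ("the commutative twisting dimension `s(n)` of the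
permanent is not quasi-polynomially bounded"), landed `--supports stmt-ValiantsHypothesis-7286`
by the line lead of `Cruxes/SDimPerNotQP/Lines/birth.lean`.

* `tdrPerNotQP_of_sDimPerNotQP` — **necessity of the semisimple stub**: the crux implies, by
  name, the sibling crux `TwistedDetRank.TdrPerNotQP` (stmt-ValiantsHypothesis-6284), which is the
  skeleton's stub `stub_tdrPerNotQP`. A representation `per_n = Σ_{t<r} det(X ∘ E_t)` is, after
  comparing coefficients of permutation monomials (`perPoly_eq_sum_twistedDet_iff`), an identity
  `sgn σ = Σ_t ∏ i, E_t (σ i) i`, i.e. a commutative realisation of `sgn_n` over the semisimple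
  algebra `Fin r → ℂ` (twists `u i j = (E_t i j)_t`, functional `Σ_t proj_t`) of dimension `r`; so a
  quasi-polynomial bound `r ≤ 2^((log₂ n + c)^c)` for every `n` is a quasi-polynomially bounded
  `s` defeating `SDimPerNotQP`. Hence the skeleton's split "X1_ss + transfer" loses nothing on the
  X1_ss side.

* `sDimPerNotQP_proof` — **THE CRUX, PROVED** (2026-08-17, line `registered` rev 10): the
  commutative twisting dimension of the permanent is not quasi-polynomially bounded. From the
  exponential lower bound `stub_expLowerBound` (every commutative realisation of `sgn_{3m}` has
  `3^m ≤ 2^m · finrank ℂ R`; Theorems/FermionizationDimensionSDimPerNotQPExpLowerBound.lean) and the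
  arithmetic `stub_expBeatsQP` / `tdrPerNotQP_qp_transfer` of the sibling crux: for a qp-bounded `s`
  with constant `c` take `m` with `2^((log₂ m + c+4)^(c+4)) · 2^m < 3^m` and `n = 3m`; then every
  realisation of `sgn_n` has `finrank R ≥ (3/2)^m > s n`.

Sources: M. Marcus, H. Minc, Illinois J. Math. 5 (1961) (the model); folklore.
-/

-- `Summit.<Summit>.<Problem>` repeats `ValiantsHypothesis` by the tree's layout convention (D-0017).
set_option linter.dupNamespace false

namespace Summit.ValiantsHypothesis.ValiantsHypothesis.Theorems

open Literature.Computability.AlgebraicComplexity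

/-- **The crux implies its semisimple stub.** `SDimPerNotQP → TwistedDetRank.TdrPerNotQP`: if the
commutative twisting dimension of the permanent is not quasi-polynomially bounded, then neither is
its twisted-determinantal rank — a length-`r` representation `per_n = Σ_{t<r} det(X ∘ E_t)` is a
commutative realisation of `sgn_n` over `Fin r → ℂ` of dimension `r`. [folklore; MarcusMinc1961] -/
theorem tdrPerNotQP_of_sDimPerNotQP :
    Summit.ValiantsHypothesis.ValiantsHypothesis.Theses.FermionizationDimension.SDimPerNotQP → Summit.ValiantsHypothesis.ValiantsHypothesis.Theses.TwistedDetRank.TdrPerNotQP := by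
  intro hS
  unfold Summit.ValiantsHypothesis.ValiantsHypothesis.Theses.TwistedDetRank.TdrPerNotQP
  rintro ⟨c, hc⟩
  -- the quasi-polynomial bound itself is a qp-bounded function `s`
  obtain ⟨n, hn⟩ := hS (fun n => 2 ^ ((Nat.log 2 n + c) ^ c)) ⟨c, fun n => le_rfl⟩
  obtain ⟨r, hr, E, hE⟩ := hc n
  -- coefficient form of the representation: `sgn σ = Σ_t ∏ i, E t (σ i) i`
  have hpat := (TwistedDetRankTdrSuperadditive.perPoly_eq_sum_twistedDet_iff E).1 hE
  -- the semisimple realisation over `Fin r → ℂ`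
  have hreal : ∀ σ : Equiv.Perm (Fin n),
      (∑ t, (LinearMap.proj t : (Fin r → ℂ) →ₗ[ℂ] ℂ)) (∏ i, (fun t => E t (σ i) i)) =
        ((Equiv.Perm.sign σ : ℤ) : ℂ) := by
    intro σ
    rw [LinearMap.sum_apply, hpat σ]
    refine Finset.sum_congr rfl fun t _ => ?_
    simp [Finset.prod_apply]
  have hlt := hn (Fin r → ℂ) (fun i j t => E t i j) (∑ t, (LinearMap.proj t : (Fin r → ℂ) →ₗ[ℂ] ℂ))
    hreal
  rw [Module.finrank_fintype_fun_eq_card, Fintype.card_fin] at hlt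
  exact absurd hr (not_le.2 hlt)

/-- **Item `stmt-ValiantsHypothesis-7286` — the crux `SDimPerNotQP`, proved.** The commutative
twisting ("fermionization") dimension of the permanent is not quasi-polynomially bounded: for every
quasi-polynomially bounded `s` there is an `n` such that every commutative finite-dimensional
`ℂ`-algebra `R` with twists `u ∈ R^{n×n}` and a functional `ℓ` realising `ℓ (∏ i, u (σ i) i) = sgn σ`
(all `σ ∈ 𝔖ₙ`) has `finrank ℂ R > s n`. Proof: with the constant `c` of `s`, pick `m` with
`2^((log₂ m + c+4)^(c+4)) · 2^m < 3^m` (`stub_expBeatsQP`) and `n = 3m`; a realisation of dimension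
`d` has `3^m ≤ 2^m d` (`stub_expLowerBound`, the determinantal flattening of the Birkhoff cubic on
`R`-points) while `s n ≤ 2^((log₂(3m)+c)^c) ≤ 2^((log₂ m + c+4)^(c+4))` (`tdrPerNotQP_qp_transfer`).
[new] -/
theorem sDimPerNotQP_proof :
    Summit.ValiantsHypothesis.ValiantsHypothesis.Theses.FermionizationDimension.SDimPerNotQP := by
  unfold Summit.ValiantsHypothesis.ValiantsHypothesis.Theses.FermionizationDimension.SDimPerNotQP
  intro s hs
  obtain ⟨c, hc⟩ := hs
  obtain ⟨m, hm⟩ := TwistedDetRankTdrPerNotQP.stub_expBeatsQP (c + 3 + 1)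
  refine ⟨m * 3, fun R _ _ _ u ℓ hu => ?_⟩
  have h1 : 3 ^ m ≤ 2 ^ m * Module.finrank ℂ R := stub_expLowerBound m R u ℓ hu
  have h2 : s (m * 3) ≤ 2 ^ ((Nat.log 2 (m * 3) + c) ^ c) := hc _
  have h3 := tdrPerNotQP_qp_transfer m 3 c
  have h4 : 2 ^ m * 2 ^ ((Nat.log 2 m + (c + 3 + 1)) ^ (c + 3 + 1)) <
      2 ^ m * Module.finrank ℂ R := by
    rw [mul_comm (2 ^ m)]
    exact lt_of_lt_of_le hm h1
  have h5 := Nat.lt_of_mul_lt_mul_left h4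
  omega

end Summit.ValiantsHypothesis.ValiantsHypothesis.Theorems
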